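import Mathlib.RingTheory.PowerSeries.Order
import Mathlib.RingTheory.MvPowerSeries.Basic
import Mathlib.LinearAlgebra.FiniteDimensional.Lemmas
import Mathlib.LinearAlgebra.Finsupp.LinearCombination
import Mathlib.RingTheory.Noetherian.Basic
import Mathlib.Data.Finsupp.Weight
import Mathlib.Tactic
import HarnessLib

/-!
# Vanishing filtration jumps of evaluation modules (Calegari–Dimitrov–Tang §3.1)

Calegari–Dimitrov–Tang [CalegariDimitrovTang2024, §3.1 "Evaluation module", pp. 32–34] attach to
a tuple of power series `f_i` and a degree bound `D` the finite-rank *evaluation module*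
`E_D = ⊕ x^k f_i` (`k < D`) inside `K⟦x⟧` (Definition 31), its *vanishing filtration jumps*
`𝒱 ⊂ ℕ` (the `x`-adic orders of its non-zero elements, §3.1.2), and prove:

* **Lemma 32** (total jumps): `#𝒱(E) = rank E` — here `ncard_jumps`, for an arbitrary
  finite-dimensional subspace `E ⊆ K⟦X⟧` over a field `K` (one-variable case of the printed
  lemma; the proof is the printed one: elements with distinct orders are independent, and
  `g ↦ (coeff_l g)_{l ∈ 𝒱}` is injective on `E`).
* **Corollary 34** (jumps of Cartesian powers): there is a sequence
  `0 ≤ u(1) < ⋯ < u(mD)` such that for every `d ≥ 1`, in every non-zero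
  `F(x_1,…,x_d) = Σ_𝐢 Q_𝐢(𝐱) f_{i_1}(x_1)⋯f_{i_d}(x_d)` with `deg_{x_j} Q_𝐢 < D`, all monomials
  `β 𝐱^𝐧` of minimal total degree have `𝐧 ∈ {u(1),…,u(mD)}^d` — here `jumps_cartesian`
  (for the `d`-fold product module `prodModule E d` of any finite-dimensional `E ⊆ K⟦X⟧`: every
  minimal-total-degree exponent of a non-zero element has all its coordinates in `𝒱(E)`) and, in
  the printed numerical form, `corollary34` (with `E = evalModule f D`, `rank = mD` from the
  `K[X]`-linear independence of `f_1,…,f_m`, `u = ` the increasing enumeration of `𝒱`).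
  Expanding the `Q_𝐢` into monomials shows that the printed `F` lie in `prodModule (evalModule f D) d`
  (`tprod_mem_prodModule_evalModule`).

**On the proof of Corollary 34.** The paper derives Cor. 34 from Lemma 33 (jumps of a Cartesian
product are the product of the jumps, for the graded-lexicographic leading exponents) together
with the second assertion of Lemma 32 ("every minimal-degree monomial of a non-zero `G ∈ E` is the
`≺`-leading monomial of some `F ∈ E`"). That second assertion does not hold for general
multivariate evaluation modules as literally stated (for the one-element module spanned by
`f = x + y` in two variables, `D = 1`, both `x` and `y` are minimal-degree monomials of `f` but only
the lexicographically smaller one is a leading monomial), so we prove Cor. 34 directly instead: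
choosing a basis `g_1,…,g_r` of `E` with pairwise distinct orders `u(k) = ord g_k` (Lemma 32),
every element of the product module is `F = Σ_𝐤 c_𝐤 g_{k_1}(x_1)⋯g_{k_d}(x_d)`, the coefficient of
`𝐱^𝐧` in `g_{k_1}(x_1)⋯g_{k_d}(x_d)` vanishes unless `𝐧 ≥ u(𝐤)` coordinatewise, and the
`u(𝐤)`-coefficient of `F` is `c_𝐤 · ∏ (leading coeffs) ≠ 0` for `𝐤` of minimal weight
`|u(𝐤)|` among `c_𝐤 ≠ 0`; hence the minimal total degree of `F` is that weight and every exponent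
of that degree is some `u(𝐤)`. (Lemma 33 itself is not needed for this and is not formalized here.)

## References
* [CalegariDimitrovTang2024] F. Calegari, V. Dimitrov, Y. Tang, *The linear independence of 1,
  ζ(2) and L(2, χ₋₃)*, arXiv:2408.15403 (2024), §3.1, Definition 31, Lemma 32, Corollary 34.
-/

namespace Literature.NumberTheory.Transcendental

namespace CalegariDimitrovTang

open PowerSeries Finset

noncomputable section

variable {K : Type*} [Field K]

/-! ### Vanishing filtration jumps of a subspace of `K⟦X⟧` -/

/-- The **vanishing filtration jumps** `𝒱(E) ⊂ ℕ` of a subspace `E ⊆ K⟦X⟧`: the set of `X`-adic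
orders of its non-zero elements. [cite: CalegariDimitrovTang2024, §3.1.2 (p. 32)] -/
def jumps (E : Submodule K K⟦X⟧) : Set ℕ := {n | ∃ g ∈ E, g ≠ 0 ∧ g.order.toNat = n}

/-- Power series with pairwise distinct orders are linearly independent.
[cite: CalegariDimitrovTang2024, §3.1.2 (the `≺`-filtration argument)] -/
theorem linearIndependent_of_order_injective {ι : Type*} (v : ι → K⟦X⟧) (hv : ∀ i, v i ≠ 0)
    (hinj : Function.Injective fun i => (v i).order.toNat) : LinearIndependent K v := by
  classical
  rw [linearIndependent_iff']
  intro s c hsum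
  by_contra hne
  push Not at hne
  obtain ⟨i, hi, hci⟩ := hne
  set t := s.filter (fun i => c i ≠ 0) with ht
  have htne : t.Nonempty := ⟨i, Finset.mem_filter.mpr ⟨hi, hci⟩⟩
  obtain ⟨i₀, hi₀, hmin⟩ := t.exists_min_image (fun i => (v i).order.toNat) htne
  obtain ⟨hi₀s, hci₀⟩ := Finset.mem_filter.mp hi₀
  set n₀ := (v i₀).order.toNat with hn₀
  have hc := congrArg (coeff n₀) hsum
  rw [map_sum, map_zero, Finset.sum_eq_single i₀] at hc
  · rw [map_smul, smul_eq_mul] at hc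
    rcases mul_eq_zero.mp hc with h | h
    · exact hci₀ h
    · exact coeff_order (hv i₀) h
  · intro j hj hji
    rw [map_smul, smul_eq_mul]
    by_cases hcj : c j = 0
    · rw [hcj, zero_mul]
    · have hjt : j ∈ t := Finset.mem_filter.mpr ⟨hj, hcj⟩
      have hle : n₀ ≤ (v j).order.toNat := hmin j hjt
      have hne' : n₀ ≠ (v j).order.toNat := fun h => hji (hinj h.symm)
      rw [coeff_of_lt_order_toNat _ (lt_of_le_of_ne hle hne'), mul_zero]
  · intro h; exact absurd hi₀s h

/-- A choice of one non-zero element of `E` of each order in `𝒱(E)`. [folklore] -/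
theorem exists_fun_jumps (E : Submodule K K⟦X⟧) :
    ∃ v : jumps E → E, ∀ l, (v l : K⟦X⟧) ≠ 0 ∧ (v l : K⟦X⟧).order.toNat = l := by
  have : ∀ l : jumps E, ∃ g : E, (g : K⟦X⟧) ≠ 0 ∧ (g : K⟦X⟧).order.toNat = l := by
    rintro ⟨l, g, hgE, hg0, hgo⟩
    exact ⟨⟨g, hgE⟩, hg0, hgo⟩
  choose v hv using this
  exact ⟨v, hv⟩

/-- The chosen elements are linearly independent in `E`. [folklore] -/
theorem linearIndependent_fun_jumps {E : Submodule K K⟦X⟧} {v : jumps E → E}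
    (hv : ∀ l, (v l : K⟦X⟧) ≠ 0 ∧ (v l : K⟦X⟧).order.toNat = l) : LinearIndependent K v := by
  have h : LinearIndependent K (fun l => (v l : K⟦X⟧)) :=
    linearIndependent_of_order_injective _ (fun l => (hv l).1) fun l μ hlμ => by
      apply Subtype.ext
      have h1 := (hv l).2; have h2 := (hv μ).2
      simp only at hlμ
      rw [h1, h2] at hlμ
      exact hlμ
  exact LinearIndependent.of_comp E.subtype h

/-- `𝒱(E)` is finite for finite-dimensional `E`. [cite: CalegariDimitrovTang2024, Lemma 32] -/
theorem jumps_finite (E : Submodule K K⟦X⟧) [FiniteDimensional K E] : (jumps E).Finite := by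
  obtain ⟨v, hv⟩ := exists_fun_jumps E
  have : Finite (jumps E) := (linearIndependent_fun_jumps hv).finite_of_isNoetherian
  exact Set.toFinite _

/-- **Lemma 32 (total jumps)**: the number of vanishing filtration jumps of a finite-dimensional
subspace `E ⊆ K⟦X⟧` equals its dimension. [cite: CalegariDimitrovTang2024, §3.1.2 Lemma 32] -/
theorem ncard_jumps (E : Submodule K K⟦X⟧) [FiniteDimensional K E] :
    (jumps E).ncard = Module.finrank K E := by
  have hfin := jumps_finite E
  haveI : Fintype (jumps E) := hfin.fintype
  obtain ⟨v, hv⟩ := exists_fun_jumps E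
  have hli := linearIndependent_fun_jumps hv
  rw [Set.ncard_eq_toFinset_card' (jumps E), Set.toFinset_card]
  apply le_antisymm
  · exact hli.fintype_card_le_finrank
  · -- `g ↦ (coeff l g)_{l ∈ 𝒱}` is injective on `E`
    let Φ : E →ₗ[K] (jumps E → K) :=
      { toFun := fun g l => coeff (l : ℕ) (g : K⟦X⟧)
        map_add' := fun g h => by funext l; simp
        map_smul' := fun c g => by funext l; simp }
    have hΦ : Function.Injective Φ := by
      rw [← LinearMap.ker_eq_bot, LinearMap.ker_eq_bot']
      intro g hg
      by_contra hg0
      have hg0' : (g : K⟦X⟧) ≠ 0 := fun h => hg0 (Subtype.ext h)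
      have hmem : (g : K⟦X⟧).order.toNat ∈ jumps E := ⟨g, g.2, hg0', rfl⟩
      have := congrFun hg ⟨_, hmem⟩
      exact coeff_order hg0' this
    calc Module.finrank K E ≤ Module.finrank K (jumps E → K) :=
          LinearMap.finrank_le_finrank_of_injective hΦ
      _ = Fintype.card (jumps E) := Module.finrank_fintype_fun_eq_card K

/-- A basis of `E` indexed by `𝒱(E)` whose `l`-th element has order exactly `l`.
[cite: CalegariDimitrovTang2024, Lemma 32] -/
theorem exists_basis_order_eq (E : Submodule K K⟦X⟧) [FiniteDimensional K E]
    [Fintype (jumps E)] :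
    ∃ b : Module.Basis (jumps E) K E, ∀ l, ((b l : E) : K⟦X⟧) ≠ 0 ∧ ((b l : E) : K⟦X⟧).order.toNat = l := by
  obtain ⟨v, hv⟩ := exists_fun_jumps E
  have hli := linearIndependent_fun_jumps hv
  have hcard : Fintype.card (jumps E) = Module.finrank K E := by
    rw [← ncard_jumps E, Set.ncard_eq_toFinset_card' (jumps E), Set.toFinset_card]
  refine ⟨basisOfLinearIndependentOfCardEqFinrank' v hli hcard, fun l => ?_⟩
  rw [coe_basisOfLinearIndependentOfCardEqFinrank']
  exact hv l

/-! ### Cartesian powers -/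

variable {d : ℕ}

/-- The product `g_1(x_1) g_2(x_2) ⋯ g_d(x_d) ∈ K⟦x_1,…,x_d⟧` of one-variable power series in
separated variables (coefficientwise: the coefficient of `𝐱^𝐧` is `∏_s coeff_{n_s} g_s`).
[cite: CalegariDimitrovTang2024, §3.1.3] -/
def tprod (g : Fin d → K⟦X⟧) : MvPowerSeries (Fin d) K := fun n => ∏ s, coeff (n s) (g s)

/-- The coefficient of `𝐱^𝐧` in `g_1(x_1)⋯g_d(x_d)` is `∏_s coeff_{n_s} g_s`. [folklore] -/
theorem coeff_tprod (g : Fin d → K⟦X⟧) (n : Fin d →₀ ℕ) :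
    MvPowerSeries.coeff n (tprod g) = ∏ s, coeff (n s) (g s) := rfl

/-- The `d`-th Cartesian power of a subspace `E ⊆ K⟦X⟧`: the span in `K⟦x_1,…,x_d⟧` of the
products `g_1(x_1)⋯g_d(x_d)`, `g_s ∈ E`. [cite: CalegariDimitrovTang2024, §3.1.3 (Cartesian
products of evaluation modules)] -/
def prodModule (E : Submodule K K⟦X⟧) (d : ℕ) : Submodule K (MvPowerSeries (Fin d) K) :=
  Submodule.span K {F | ∃ g : Fin d → K⟦X⟧, (∀ s, g s ∈ E) ∧ tprod g = F}

/-- Products of elements of `E` lie in the product module. [folklore] -/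
theorem tprod_mem_prodModule {E : Submodule K K⟦X⟧} {g : Fin d → K⟦X⟧} (hg : ∀ s, g s ∈ E) :
    tprod g ∈ prodModule E d :=
  Submodule.subset_span ⟨g, hg, rfl⟩

/-- Multilinear expansion: in terms of a basis `b` of `E`, every product `g_1(x_1)⋯g_d(x_d)` with
`g_s ∈ E` is a combination of the products `b_{k_1}(x_1)⋯b_{k_d}(x_d)`. [folklore] -/
theorem tprod_eq_sum_basis {ι : Type*} [Fintype ι] {E : Submodule K K⟦X⟧} (b : Module.Basis ι K E)
    (g : Fin d → K⟦X⟧) (hg : ∀ s, g s ∈ E) :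
    tprod g = ∑ k : Fin d → ι, (∏ s, b.repr ⟨g s, hg s⟩ (k s)) •
      tprod (fun s => ((b (k s) : E) : K⟦X⟧)) := by
  classical
  have hgs : ∀ s, g s = ∑ i, b.repr ⟨g s, hg s⟩ i • ((b i : E) : K⟦X⟧) := by
    intro s
    have h := b.sum_repr ⟨g s, hg s⟩
    have h' := congrArg (fun x : E => (x : K⟦X⟧)) h
    simp only [Submodule.coe_sum, Submodule.coe_smul] at h'
    exact h'.symm
  ext n
  rw [coeff_tprod, map_sum]
  simp_rw [map_smul, coeff_tprod, smul_eq_mul]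
  have : ∀ s, coeff (n s) (g s) = ∑ i, b.repr ⟨g s, hg s⟩ i * coeff (n s) ((b i : E) : K⟦X⟧) := by
    intro s
    conv_lhs => rw [hgs s]
    rw [map_sum]
    simp_rw [map_smul, smul_eq_mul]
  simp_rw [this]
  rw [Finset.prod_univ_sum (fun _ => (Finset.univ : Finset ι))]
  simp only [Fintype.piFinset_univ]
  refine Finset.sum_congr rfl fun k _ => ?_
  rw [Finset.prod_mul_distrib]

/-- The product module is spanned by the products of basis elements. [folklore] -/
theorem prodModule_le_span_basis {ι : Type*} [Fintype ι] {E : Submodule K K⟦X⟧} (b : Module.Basis ι K E)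
    (d : ℕ) :
    prodModule E d ≤ Submodule.span K (Set.range fun k : Fin d → ι =>
      tprod (fun s => ((b (k s) : E) : K⟦X⟧))) := by
  refine Submodule.span_le.mpr ?_
  rintro F ⟨g, hg, rfl⟩
  rw [tprod_eq_sum_basis b g hg]
  refine Submodule.sum_mem _ fun k _ => Submodule.smul_mem _ _ (Submodule.subset_span ⟨k, rfl⟩)

/-- Coordinatewise `≤` with equal total degrees forces equality. [folklore] -/
theorem Finsupp.eq_of_le_of_degree_eq {n m : Fin d →₀ ℕ} (hle : ∀ s, m s ≤ n s)
    (hdeg : n.degree ≤ m.degree) : n = m := by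
  rw [Finsupp.degree_eq_sum, Finsupp.degree_eq_sum] at hdeg
  have heq : ∀ s ∈ (Finset.univ : Finset (Fin d)), m s = n s :=
    (Finset.sum_eq_sum_iff_of_le fun s _ => hle s).mp (le_antisymm (Finset.sum_le_sum fun s _ => hle s) hdeg)
  ext s
  exact (heq s (Finset.mem_univ s)).symm

/-- **Corollary 34 (jumps of Cartesian powers), structural form.** Let `E ⊆ K⟦X⟧` be a
finite-dimensional subspace with vanishing filtration jumps `𝒱(E)`. For every `d` and every
non-zero `F` in the `d`-th Cartesian power `prodModule E d ⊆ K⟦x_1,…,x_d⟧`, every exponent `𝐧`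
of a monomial of `F` of minimal total degree has all its coordinates in `𝒱(E)`:
`𝐧 ∈ 𝒱(E)^d`. [cite: CalegariDimitrovTang2024, §3.1.3 Corollary 34] -/
theorem jumps_cartesian (E : Submodule K K⟦X⟧) [FiniteDimensional K E] {F : MvPowerSeries (Fin d) K}
    (hF : F ∈ prodModule E d) {n : Fin d →₀ ℕ} (hn : MvPowerSeries.coeff n F ≠ 0)
    (hmin : ∀ n' : Fin d →₀ ℕ, MvPowerSeries.coeff n' F ≠ 0 → n.degree ≤ n'.degree) :
    ∀ s, n s ∈ jumps E := by
  classical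
  haveI : Fintype (jumps E) := (jumps_finite E).fintype
  obtain ⟨b, hb⟩ := exists_basis_order_eq E
  -- write `F = Σ_k c_k T_k` on the product basis
  set T : (Fin d → jumps E) → MvPowerSeries (Fin d) K :=
    fun k => tprod (fun s => ((b (k s) : E) : K⟦X⟧)) with hT
  obtain ⟨c, hc⟩ := (Submodule.mem_span_range_iff_exists_fun (R := K)).mp (prodModule_le_span_basis b d hF)
  -- the exponent `U k = (u(k_1), …, u(k_d))`
  let U : (Fin d → jumps E) → (Fin d →₀ ℕ) :=
    fun k => Finsupp.equivFunOnFinite.symm (fun s => ((k s : jumps E) : ℕ))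
  have hU : ∀ k s, U k s = ((k s : jumps E) : ℕ) := fun k s => rfl
  have hUinj : Function.Injective U := by
    intro k k' h
    funext s
    apply Subtype.ext
    rw [← hU k s, ← hU k' s, h]
  -- (T1) `coeff 𝐧 (T k) ≠ 0 → U k ≤ 𝐧` coordinatewise
  have hT1 : ∀ k m, MvPowerSeries.coeff m (T k) ≠ 0 → ∀ s, U k s ≤ m s := by
    intro k m hkm s
    rw [hT, coeff_tprod] at hkm
    have hs : coeff (m s) ((b (k s) : E) : K⟦X⟧) ≠ 0 := fun h => hkm (Finset.prod_eq_zero (mem_univ s) h)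
    rw [hU, ← (hb (k s)).2]
    by_contra hlt
    push Not at hlt
    exact hs (coeff_of_lt_order_toNat _ hlt)
  -- (T2) `coeff (U k) (T k) ≠ 0`
  have hT2 : ∀ k, MvPowerSeries.coeff (U k) (T k) ≠ 0 := by
    intro k
    rw [hT, coeff_tprod]
    refine Finset.prod_ne_zero_iff.mpr fun s _ => ?_
    rw [hU, ← (hb (k s)).2]
    exact coeff_order (hb (k s)).1
  -- the coefficient extraction of `F`
  have hcoeffF : ∀ m, MvPowerSeries.coeff m F = ∑ k, c k * MvPowerSeries.coeff m (T k) := by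
    intro m
    rw [← hc, map_sum]
    simp_rw [map_smul, smul_eq_mul]
    rfl
  -- the set of `k` with `c k ≠ 0` is non-empty
  set A := (Finset.univ : Finset (Fin d → jumps E)).filter (fun k => c k ≠ 0) with hA
  have hAne : A.Nonempty := by
    by_contra hempty
    rw [Finset.not_nonempty_iff_eq_empty] at hempty
    apply hn
    rw [hcoeffF]
    refine Finset.sum_eq_zero fun k _ => ?_
    have : c k = 0 := by
      by_contra hck
      have : k ∈ A := Finset.mem_filter.mpr ⟨mem_univ k, hck⟩
      rw [hempty] at this
      exact absurd this (Finset.notMem_empty k)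
    rw [this, zero_mul]
  -- `k₁` of minimal weight among `c k ≠ 0`
  obtain ⟨k₁, hk₁A, hk₁min⟩ := A.exists_min_image (fun k => (U k).degree) hAne
  have hck₁ : c k₁ ≠ 0 := (Finset.mem_filter.mp hk₁A).2
  -- `coeff (U k₁) F ≠ 0`
  have hFk₁ : MvPowerSeries.coeff (U k₁) F ≠ 0 := by
    rw [hcoeffF, Finset.sum_eq_single k₁]
    · exact mul_ne_zero hck₁ (hT2 k₁)
    · intro k _ hkk₁
      by_cases hck : c k = 0
      · rw [hck, zero_mul]
      · by_contra hne
        have hne' : MvPowerSeries.coeff (U k₁) (T k) ≠ 0 := fun h => hne (by rw [h, mul_zero])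
        have hle := hT1 k (U k₁) hne'
        have hkA : k ∈ A := Finset.mem_filter.mpr ⟨mem_univ k, hck⟩
        have hdeg : (U k₁).degree ≤ (U k).degree := hk₁min k hkA
        exact hkk₁ (hUinj (Finsupp.eq_of_le_of_degree_eq hle hdeg)).symm
    · intro h; exact absurd (mem_univ k₁) h
  -- a `k` with `c k ≠ 0` contributing to `coeff 𝐧 F`
  obtain ⟨k, _, hk⟩ := Finset.exists_ne_zero_of_sum_ne_zero (by rw [← hcoeffF]; exact hn)
  have hck : c k ≠ 0 := fun h => hk (by rw [h, zero_mul])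
  have hkT : MvPowerSeries.coeff n (T k) ≠ 0 := fun h => hk (by rw [h, mul_zero])
  have hle := hT1 k n hkT
  -- degrees: `deg 𝐧 ≤ deg U k₁ ≤ deg U k ≤ deg 𝐧`
  have h1 : n.degree ≤ (U k₁).degree := hmin _ hFk₁
  have h2 : (U k₁).degree ≤ (U k).degree := hk₁min k (Finset.mem_filter.mpr ⟨mem_univ k, hck⟩)
  have hnU : n = U k := Finsupp.eq_of_le_of_degree_eq hle (h1.trans h2)
  intro s
  rw [hnU, hU]
  exact (k s).2

/-! ### The evaluation module `E_D` of Definition 31 and the printed form of Corollary 34 -/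

variable {m : ℕ}

/-- The **evaluation module** `E_D = Σ_{i ≤ m, k < D} K · x^k f_i(x) ⊆ K⟦x⟧` of the tuple
`f_1, …, f_m` (the image of `ψ_D` in Definition 31, one variable, `Ω = [0,1)`).
[cite: CalegariDimitrovTang2024, §3.1.1 Definition 31] -/
def evalModule (f : Fin m → K⟦X⟧) (D : ℕ) : Submodule K K⟦X⟧ :=
  Submodule.span K (Set.range fun p : Fin m × Fin D => (X : K⟦X⟧) ^ (p.2 : ℕ) * f p.1)

/-- `E_D` is finite-dimensional (spanned by `mD` elements). [folklore] -/
instance finiteDimensional_evalModule (f : Fin m → K⟦X⟧) (D : ℕ) :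
    FiniteDimensional K (evalModule f D) := by
  unfold evalModule
  exact FiniteDimensional.span_of_finite K (Set.finite_range _)

/-- The terms `x^𝐤 f_{i_1}(x_1)⋯f_{i_d}(x_d)` (`k_s < D`) of the printed auxiliary functions lie in
the `d`-th Cartesian power of `E_D`. [cite: CalegariDimitrovTang2024, §3.1.3] -/
theorem tprod_mem_prodModule_evalModule (f : Fin m → K⟦X⟧) (D : ℕ) (i : Fin d → Fin m)
    (k : Fin d → ℕ) (hk : ∀ s, k s < D) :
    tprod (fun s => (X : K⟦X⟧) ^ (k s) * f (i s)) ∈ prodModule (evalModule f D) d :=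
  tprod_mem_prodModule fun s => Submodule.subset_span ⟨(i s, ⟨k s, hk s⟩), rfl⟩

/-- `K[X]`-linear independence of `f_1,…,f_m` gives `K`-linear independence of the `x^k f_i`.
[cite: CalegariDimitrovTang2024, §3.1.1 (injectivity of `ψ_D`)] -/
theorem linearIndependent_X_pow_mul (f : Fin m → K⟦X⟧) (hf : LinearIndependent (Polynomial K) f)
    (D : ℕ) : LinearIndependent K (fun p : Fin m × Fin D => (X : K⟦X⟧) ^ (p.2 : ℕ) * f p.1) := by
  classical
  rw [Fintype.linearIndependent_iff]
  intro g hg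
  -- the polynomials `P_i = Σ_k g(i,k) X^k`
  set P : Fin m → Polynomial K := fun i => ∑ k : Fin D, Polynomial.C (g (i, k)) * Polynomial.X ^ (k : ℕ)
    with hP
  have hPf : ∑ i, P i • f i = 0 := by
    have : ∀ i, P i • f i = ∑ k : Fin D, g (i, k) • ((X : K⟦X⟧) ^ (k : ℕ) * f i) := by
      intro i
      rw [hP]
      simp only
      rw [Finset.sum_smul]
      refine Finset.sum_congr rfl fun k _ => ?_
      rw [Algebra.smul_def, algebraMap_apply', Algebra.algebraMap_self]
      simp only [map_id, id_eq, Polynomial.coe_mul, Polynomial.coe_pow, Polynomial.coe_C,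
        Polynomial.coe_X]
      rw [smul_eq_C_mul, mul_assoc]
    simp_rw [this]
    rw [← hg, ← Finset.sum_product' (f := fun i k => g (i, k) • ((X : K⟦X⟧) ^ (k : ℕ) * f i)),
      Finset.univ_product_univ]
  have hP0 : ∀ i, P i = 0 := Fintype.linearIndependent_iff.mp hf P hPf
  rintro ⟨i, k⟩
  have h := congrArg (fun p : Polynomial K => p.coeff k) (hP0 i)
  simp only [hP, Polynomial.finsetSum_coeff, Polynomial.coeff_C_mul_X_pow, Polynomial.coeff_zero] at h
  rw [Finset.sum_eq_single k] at h
  · simpa using h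
  · intro k' _ hk'
    rw [if_neg]
    exact fun h' => hk' (Fin.ext h').symm
  · intro h'; exact absurd (mem_univ k) h'

/-- `rank E_D = mD`. [cite: CalegariDimitrovTang2024, proof of Corollary 34 ("Clearly,
rank(E_D) = mD")] -/
theorem finrank_evalModule (f : Fin m → K⟦X⟧) (hf : LinearIndependent (Polynomial K) f) (D : ℕ) :
    Module.finrank K (evalModule f D) = m * D := by
  rw [evalModule, finrank_span_eq_card (linearIndependent_X_pow_mul f hf D), Fintype.card_prod,
    Fintype.card_fin, Fintype.card_fin]

/-- **Corollary 34** (as printed). Let `f_1,…,f_m ∈ K⟦x⟧` be `K[x]`- (equivalently `K(x)`-)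
linearly independent and `D ≥ 1`. There is a strictly increasing sequence
`0 ≤ u(1) < ⋯ < u(mD)` of non-negative integers such that for every `d` and every non-zero
`F` in the `d`-th Cartesian power of the evaluation module `E_D` (this contains every
`Σ_𝐢 Q_𝐢(𝐱) f_{i_1}(x_1)⋯f_{i_d}(x_d)` with `deg_{x_j} Q_𝐢 < D`, see
`tprod_mem_prodModule_evalModule`), all monomials `β𝐱^𝐧` of minimal total degree have
`𝐧 ∈ {u(1),…,u(mD)}^d`. [cite: CalegariDimitrovTang2024, §3.1.3 Corollary 34] -/
theorem corollary34 (f : Fin m → K⟦X⟧) (hf : LinearIndependent (Polynomial K) f) (D : ℕ) :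
    ∃ u : Fin (m * D) → ℕ, StrictMono u ∧
      ∀ (d : ℕ) (F : MvPowerSeries (Fin d) K), F ∈ prodModule (evalModule f D) d →
        ∀ n : Fin d →₀ ℕ, MvPowerSeries.coeff n F ≠ 0 →
          (∀ n' : Fin d →₀ ℕ, MvPowerSeries.coeff n' F ≠ 0 → n.degree ≤ n'.degree) →
            ∀ s, n s ∈ Set.range u := by
  have hfin := jumps_finite (evalModule f D)
  have hcard : hfin.toFinset.card = m * D := by
    rw [← Set.ncard_eq_toFinset_card _ hfin, ncard_jumps, finrank_evalModule f hf D]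
  refine ⟨fun j => hfin.toFinset.orderEmbOfFin hcard j, (hfin.toFinset.orderEmbOfFin hcard).strictMono,
    fun d F hF n hn hmin s => ?_⟩
  have hs : n s ∈ (hfin.toFinset : Set ℕ) := hfin.mem_toFinset.mpr (jumps_cartesian _ hF hn hmin s)
  rw [← Finset.range_orderEmbOfFin _ hcard] at hs
  obtain ⟨j, hj⟩ := hs
  exact ⟨j, hj⟩

end

end CalegariDimitrovTang

end Literature.NumberTheory.Transcendental
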